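import Mathlib
import Summits.AtomisticToContinuum.FouriersLaw.Theorems.EmbeddedDrudeMourreMourreDissolutionResonanceFactorisation
import Summits.AtomisticToContinuum.FouriersLaw.Theorems.EmbeddedDrudeMourreMourreDissolutionContinuousDensityAssemblyAux
import Summits.AtomisticToContinuum.FouriersLaw.Theorems.EmbeddedDrudeMourreDrudeDissolutionFluxPointwise
import Summits.AtomisticToContinuum.FouriersLaw.Theorems.EmbeddedDrudeMourreDrudeDissolutionGradFluxGlue
import HarnessLib

/-!
# The product structure `Ω = −A·S₁·S₂` of the pair resonance on `ℝ³`
(crux `EmbeddedDrudeMourre.DrudeDissolution`, item stmt-AtomisticToContinuum-12593; `--supports` file for the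
registered sub-goal `resonance_product_structure` of stub B1b″ `stub_excursionSecondDifference` of line
`kinetic-polymer-gas-on-the-time-axis`; closes nothing; lead c13 (process B), 2026-08-17)

WHAT. Read at `p = (k₁,(k₃,k₂))`, the free pair resonance `Ω(p) = resonanceFn ω₂ p.1 p.2.2 p.2.1` factorises
(`MourreDissolution.stub_resonanceFactorisation`, dividing by the positive factor
`Q = (ω₁+ω₂+ω₃+ω₄)(ω₁ω₂+ω₃ω₄)`) as `Ω = −A·S₁·S₂` with the two exchange-plane sines
`S₁ = sin((k₃−k₁)/2)`, `S₂ = sin((k₃−k₂)/2)` and the smooth sheet amplitude `A = 8H/Q`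
(`resonance_product_identity`). We record: smoothness of `A`, `S₁`, `S₂` (`resonance_contDiff_A/S₁/S₂`),
`4π`-periodicity of `A` in each coordinate (`resonance_A_periodic`), a generic compactness bound for continuous
triply-periodic functions (`exists_bound_of_periodic3`), and from it uniform bounds on `A` and its first two
derivatives along any three directions (`resonance_A_bounds`), the first derivatives of `S₁`, `S₂` and the
product rule for `DΩ` (`resonance_fderiv_S₁/S₂/Omega`); the registered sub-goal `resonance_product_structure`
packages identity, smoothness and product rule.

WHY (role). Items (C2)/(C4) of the remaining concrete work for B1b″ (sup-norm route): the structure bounds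
`|∂²Ω| ≤ Cₙ(|A|+|S₁|+|S₂|)` and the Morse–Bott gradient floor `D ≥ c(A²S₁²+A²S₂²+S₁²S₂²)` are both read off
this product structure.
-/

noncomputable section

open scoped Topology
open Set Filter

namespace Summit.AtomisticToContinuum.FouriersLaw.Theorems.DrudeDissolution.KineticPolymerGasOnTheTimeAxis

open Literature.MathematicalPhysics.KineticTheory
open Literature.MathematicalPhysics.KineticTheory.PhononBoltzmann

/-! ### A compactness bound for triply periodic continuous functions -/

/-- A continuous function on `ℝ³` which is `T`-periodic in each of the three coordinates is bounded.
[folklore] -/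
theorem exists_bound_of_periodic3 {f : ℝ × ℝ × ℝ → ℝ} (hf : Continuous f) {T : ℝ} (hT : 0 < T)
    (h1 : ∀ q : ℝ × ℝ × ℝ, f (q + (T, 0, 0)) = f q) (h2 : ∀ q : ℝ × ℝ × ℝ, f (q + (0, T, 0)) = f q)
    (h3 : ∀ q : ℝ × ℝ × ℝ, f (q + (0, 0, T)) = f q) : ∃ C : ℝ, ∀ p, |f p| ≤ C := by
  have hK : IsCompact (Icc (0 : ℝ) T ×ˢ (Icc (0 : ℝ) T ×ˢ Icc (0 : ℝ) T)) :=
    isCompact_Icc.prod (isCompact_Icc.prod isCompact_Icc)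
  obtain ⟨C, hC⟩ := hK.exists_bound_of_continuousOn hf.continuousOn
  -- integer iterates of the three periods
  have i1 : ∀ (n : ℤ) (x y z : ℝ), f (x + n * T, y, z) = f (x, y, z) := fun n x y z => by
    have hper : Function.Periodic (fun s : ℝ => f (s, y, z)) T := fun s => by
      have := h1 (s, y, z); simpa [Prod.add_def] using this
    exact hper.int_mul n x
  have i2 : ∀ (n : ℤ) (x y z : ℝ), f (x, y + n * T, z) = f (x, y, z) := fun n x y z => by
    have hper : Function.Periodic (fun s : ℝ => f (x, s, z)) T := fun s => by
      have := h2 (x, s, z); simpa [Prod.add_def] using this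
    exact hper.int_mul n y
  have i3 : ∀ (n : ℤ) (x y z : ℝ), f (x, y, z + n * T) = f (x, y, z) := fun n x y z => by
    have hper : Function.Periodic (fun s : ℝ => f (x, y, s)) T := fun s => by
      have := h3 (x, y, s); simpa [Prod.add_def] using this
    exact hper.int_mul n z
  -- reduction of a real number into `[0, T]`
  have red : ∀ x : ℝ, ∃ n : ℤ, x - n * T ∈ Icc (0 : ℝ) T := fun x => by
    refine ⟨⌊x / T⌋, ?_, ?_⟩
    · have h := Int.floor_le (x / T)
      have : (⌊x / T⌋ : ℝ) * T ≤ x := by rwa [le_div_iff₀ hT] at h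
      linarith
    · have h := Int.lt_floor_add_one (x / T)
      have : x < ((⌊x / T⌋ : ℝ) + 1) * T := by rwa [div_lt_iff₀ hT] at h
      nlinarith
  refine ⟨C, fun p => ?_⟩
  obtain ⟨x, y, z⟩ := p
  obtain ⟨n₁, hn₁⟩ := red x
  obtain ⟨n₂, hn₂⟩ := red y
  obtain ⟨n₃, hn₃⟩ := red z
  have hmem : ((x - n₁ * T, y - n₂ * T, z - n₃ * T) : ℝ × ℝ × ℝ) ∈
      Icc (0 : ℝ) T ×ˢ (Icc (0 : ℝ) T ×ˢ Icc (0 : ℝ) T) := ⟨hn₁, hn₂, hn₃⟩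
  have hval : f (x, y, z) = f (x - n₁ * T, y - n₂ * T, z - n₃ * T) := by
    have e1 := i1 n₁ (x - n₁ * T) (y - n₂ * T) (z - n₃ * T)
    have e2 := i2 n₂ x (y - n₂ * T) (z - n₃ * T)
    have e3 := i3 n₃ x y (z - n₃ * T)
    simp only [sub_add_cancel] at e1 e2 e3
    rw [e3, e2, e1]
  have := hC _ hmem
  rw [Real.norm_eq_abs] at this
  rwa [hval]

/-- From finitely many bounds to one: `∀ i j, ∃ C, P i j C` with `P` monotone in `C` gives a common `C`
(here for `Fin 3 × Fin 3`-indexed absolute-value bounds). [folklore] -/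
theorem exists_common_bound {ι : Type*} [Fintype ι] {g : ι → ℝ × ℝ × ℝ → ℝ}
    (h : ∀ i, ∃ C : ℝ, ∀ p, |g i p| ≤ C) : ∃ C : ℝ, 0 ≤ C ∧ ∀ i p, |g i p| ≤ C := by
  classical
  choose C hC using h
  refine ⟨∑ i, |C i|, Finset.sum_nonneg fun i _ => abs_nonneg _, fun i p => ?_⟩
  calc |g i p| ≤ C i := hC i p
    _ ≤ |C i| := le_abs_self _
    _ ≤ ∑ j, |C j| := Finset.single_le_sum (f := fun j => |C j|) (fun j _ => abs_nonneg _) (Finset.mem_univ i)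

/-! ### The objects (free functions with defining hypotheses) -/

section Structure

variable {ω₂ : ℝ} (hω : 0 < ω₂) {A S₁ S₂ : ℝ × ℝ × ℝ → ℝ}
  (hS₁ : ∀ p : ℝ × ℝ × ℝ, S₁ p = Real.sin ((p.2.1 - p.1) / 2))
  (hS₂ : ∀ p : ℝ × ℝ × ℝ, S₂ p = Real.sin ((p.2.1 - p.2.2) / 2))
  (hA : ∀ p : ℝ × ℝ × ℝ, A p =
    8 * ((dispersion ω₂ p.1 * dispersion ω₂ p.2.2 +
            dispersion ω₂ p.2.1 * dispersion ω₂ (p.1 + p.2.2 - p.2.1) + 2 * (ω₂ + 2)) *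
          Real.cos ((p.1 + p.2.2) / 2) -
        4 * Real.cos ((p.2.1 - p.1) / 2) * Real.cos ((p.2.2 - p.2.1) / 2)) /
      ((dispersion ω₂ p.1 + dispersion ω₂ p.2.2 + dispersion ω₂ p.2.1 + dispersion ω₂ (p.1 + p.2.2 - p.2.1)) *
        (dispersion ω₂ p.1 * dispersion ω₂ p.2.2 + dispersion ω₂ p.2.1 * dispersion ω₂ (p.1 + p.2.2 - p.2.1))))

include hω in
/-- The normalising factor `Q = (ω₁+ω₂+ω₃+ω₄)(ω₁ω₂+ω₃ω₄)` is positive (`ω > 0` for `ω₂ > 0`). [folklore] -/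
theorem resonance_Q_pos (p : ℝ × ℝ × ℝ) :
    0 < (dispersion ω₂ p.1 + dispersion ω₂ p.2.2 + dispersion ω₂ p.2.1 + dispersion ω₂ (p.1 + p.2.2 - p.2.1)) *
      (dispersion ω₂ p.1 * dispersion ω₂ p.2.2 + dispersion ω₂ p.2.1 * dispersion ω₂ (p.1 + p.2.2 - p.2.1)) := by
  have h1 := dispersion_pos hω p.1
  have h2 := dispersion_pos hω p.2.2
  have h3 := dispersion_pos hω p.2.1
  have h4 := dispersion_pos hω (p.1 + p.2.2 - p.2.1)
  positivity

include hω hS₁ hS₂ hA in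
/-- **The product identity `Ω = −A·S₁·S₂`** (from `stub_resonanceFactorisation`, dividing by `Q > 0`).
[folklore] -/
theorem resonance_product_identity (p : ℝ × ℝ × ℝ) :
    resonanceFn ω₂ p.1 p.2.2 p.2.1 = -(A p * S₁ p * S₂ p) := by
  have hQ := resonance_Q_pos hω p
  have h := MourreDissolution.stub_resonanceFactorisation ω₂ hω.le p.1 p.2.2 p.2.1
  have hs : Real.sin ((p.2.2 - p.2.1) / 2) = -S₂ p := by
    rw [hS₂, ← Real.sin_neg]; congr 1; ring
  rw [hs, ← hS₁] at h
  rw [hA]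
  set Q := (dispersion ω₂ p.1 + dispersion ω₂ p.2.2 + dispersion ω₂ p.2.1 + dispersion ω₂ (p.1 + p.2.2 - p.2.1)) *
    (dispersion ω₂ p.1 * dispersion ω₂ p.2.2 + dispersion ω₂ p.2.1 * dispersion ω₂ (p.1 + p.2.2 - p.2.1)) with hQdef
  set H := (dispersion ω₂ p.1 * dispersion ω₂ p.2.2 + dispersion ω₂ p.2.1 * dispersion ω₂ (p.1 + p.2.2 - p.2.1) +
      2 * (ω₂ + 2)) * Real.cos ((p.1 + p.2.2) / 2) -
    4 * Real.cos ((p.2.1 - p.1) / 2) * Real.cos ((p.2.2 - p.2.1) / 2) with hHdef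
  have hΩ : resonanceFn ω₂ p.1 p.2.2 p.2.1 = 8 * S₁ p * -S₂ p * H / Q := eq_div_of_mul_eq hQ.ne' h
  rw [hΩ]
  ring

/-! ### Smoothness -/

include hω in
/-- The band is smooth. [folklore] -/
theorem resonance_contDiff_dispersion (n : ℕ) : ContDiff ℝ n (dispersion ω₂) :=
  contDiff_iff_contDiffAt.2 fun k => (analyticAt_dispersion hω k).contDiffAt

include hS₁ in
/-- `S₁` is smooth. [folklore] -/
theorem resonance_contDiff_S₁ (n : ℕ) : ContDiff ℝ n S₁ := by
  rw [show S₁ = fun p : ℝ × ℝ × ℝ => Real.sin ((p.2.1 - p.1) / 2) from funext hS₁]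
  exact Real.contDiff_sin.comp (((contDiff_fst.comp contDiff_snd).sub contDiff_fst).div_const 2)

include hS₂ in
/-- `S₂` is smooth. [folklore] -/
theorem resonance_contDiff_S₂ (n : ℕ) : ContDiff ℝ n S₂ := by
  rw [show S₂ = fun p : ℝ × ℝ × ℝ => Real.sin ((p.2.1 - p.2.2) / 2) from funext hS₂]
  exact Real.contDiff_sin.comp (((contDiff_fst.comp contDiff_snd).sub (contDiff_snd.comp contDiff_snd)).div_const 2)

include hω hA in
/-- The sheet amplitude `A = 8H/Q` is smooth. [folklore] -/
theorem resonance_contDiff_A (n : ℕ) : ContDiff ℝ n A := by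
  rw [show A = _ from funext hA]
  have hd := resonance_contDiff_dispersion hω n
  have c1 : ContDiff ℝ n fun p : ℝ × ℝ × ℝ => p.1 := contDiff_fst
  have c3 : ContDiff ℝ n fun p : ℝ × ℝ × ℝ => p.2.1 := contDiff_fst.comp contDiff_snd
  have c2 : ContDiff ℝ n fun p : ℝ × ℝ × ℝ => p.2.2 := contDiff_snd.comp contDiff_snd
  have w1 := hd.comp c1
  have w2 := hd.comp c2
  have w3 := hd.comp c3
  have w4 := hd.comp ((c1.add c2).sub c3)
  refine ContDiff.div ?_ ?_ fun p => (resonance_Q_pos hω p).ne'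
  · refine contDiff_const.mul ?_
    refine ContDiff.sub ?_ ?_
    · exact (((w1.mul w2).add (w3.mul w4)).add contDiff_const).mul
        (Real.contDiff_cos.comp ((c1.add c2).div_const 2))
    · exact ((contDiff_const.mul (Real.contDiff_cos.comp ((c3.sub c1).div_const 2))).mul
        (Real.contDiff_cos.comp ((c2.sub c3).div_const 2)))
  · exact ((w1.add w2).add w3 |>.add w4).mul ((w1.mul w2).add (w3.mul w4))

include hω in
/-- `Ω` read at `p = (k₁,(k₃,k₂))` is smooth. [folklore] -/
theorem resonance_contDiff_Omega (n : ℕ) :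
    ContDiff ℝ n fun p : ℝ × ℝ × ℝ => resonanceFn ω₂ p.1 p.2.2 p.2.1 := by
  have hd := resonance_contDiff_dispersion hω n
  have c1 : ContDiff ℝ n fun p : ℝ × ℝ × ℝ => p.1 := contDiff_fst
  have c3 : ContDiff ℝ n fun p : ℝ × ℝ × ℝ => p.2.1 := contDiff_fst.comp contDiff_snd
  have c2 : ContDiff ℝ n fun p : ℝ × ℝ × ℝ => p.2.2 := contDiff_snd.comp contDiff_snd
  unfold resonanceFn
  exact (((hd.comp c1).add (hd.comp c2)).sub (hd.comp c3)).sub (hd.comp ((c1.add c2).sub c3))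

/-! ### Periodicity (period `4π` for the half-angle objects) -/

/-- `ω(k + 4π) = ω(k)`. [folklore] -/
theorem resonance_dispersion_add_four_pi (k : ℝ) : dispersion ω₂ (k + 4 * Real.pi) = dispersion ω₂ k := by
  unfold dispersion
  rw [show k + 4 * Real.pi = k + 2 * Real.pi + 2 * Real.pi by ring, Real.cos_add_two_pi, Real.cos_add_two_pi]

/-- `ω(k − 4π) = ω(k)`. [folklore] -/
theorem resonance_dispersion_sub_four_pi (k : ℝ) : dispersion ω₂ (k - 4 * Real.pi) = dispersion ω₂ k := by
  have := resonance_dispersion_add_four_pi (ω₂ := ω₂) (k - 4 * Real.pi)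
  rw [sub_add_cancel] at this
  exact this.symm

include hA in
/-- `A` is `4π`-periodic in each coordinate. [folklore] -/
theorem resonance_A_periodic :
    (∀ q : ℝ × ℝ × ℝ, A (q + (4 * Real.pi, 0, 0)) = A q) ∧ (∀ q : ℝ × ℝ × ℝ, A (q + (0, 4 * Real.pi, 0)) = A q) ∧
      (∀ q : ℝ × ℝ × ℝ, A (q + (0, 0, 4 * Real.pi)) = A q) := by
  have cadd : ∀ x : ℝ, Real.cos (x + 2 * Real.pi) = Real.cos x := Real.cos_add_two_pi
  have csub : ∀ x : ℝ, Real.cos (x - 2 * Real.pi) = Real.cos x := Real.cos_sub_two_pi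
  refine ⟨fun q => ?_, fun q => ?_, fun q => ?_⟩
  · rw [hA, hA]
    simp only [Prod.fst_add, Prod.snd_add, add_zero]
    rw [show q.1 + 4 * Real.pi + q.2.2 - q.2.1 = (q.1 + q.2.2 - q.2.1) + 4 * Real.pi by ring,
      resonance_dispersion_add_four_pi, resonance_dispersion_add_four_pi,
      show (q.1 + 4 * Real.pi + q.2.2) / 2 = (q.1 + q.2.2) / 2 + 2 * Real.pi by ring, cadd,
      show (q.2.1 - (q.1 + 4 * Real.pi)) / 2 = (q.2.1 - q.1) / 2 - 2 * Real.pi by ring, csub]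
  · rw [hA, hA]
    simp only [Prod.fst_add, Prod.snd_add, add_zero]
    rw [show q.1 + q.2.2 - (q.2.1 + 4 * Real.pi) = (q.1 + q.2.2 - q.2.1) - 4 * Real.pi by ring,
      resonance_dispersion_sub_four_pi, resonance_dispersion_add_four_pi,
      show (q.2.1 + 4 * Real.pi - q.1) / 2 = (q.2.1 - q.1) / 2 + 2 * Real.pi by ring, cadd,
      show (q.2.2 - (q.2.1 + 4 * Real.pi)) / 2 = (q.2.2 - q.2.1) / 2 - 2 * Real.pi by ring, csub]
  · rw [hA, hA]
    simp only [Prod.fst_add, Prod.snd_add, add_zero]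
    rw [show q.1 + (q.2.2 + 4 * Real.pi) - q.2.1 = (q.1 + q.2.2 - q.2.1) + 4 * Real.pi by ring,
      resonance_dispersion_add_four_pi, resonance_dispersion_add_four_pi,
      show (q.1 + (q.2.2 + 4 * Real.pi)) / 2 = (q.1 + q.2.2) / 2 + 2 * Real.pi by ring, cadd,
      show (q.2.2 + 4 * Real.pi - q.2.1) / 2 = (q.2.2 - q.2.1) / 2 + 2 * Real.pi by ring, cadd]

/-! ### Uniform bounds on `A` and its first two derivatives -/

/-- Periodicity passes to the Fréchet derivative (any codomain). [folklore] -/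
theorem fderiv_periodic_vec {F : Type*} [NormedAddCommGroup F] [NormedSpace ℝ F] {g : ℝ × ℝ × ℝ → F}
    {T : ℝ × ℝ × ℝ} (hg : ∀ q, g (q + T) = g q) (p : ℝ × ℝ × ℝ) : fderiv ℝ g (p + T) = fderiv ℝ g p := by
  have hfun : (fun x => g (x + T)) = g := funext hg
  rw [← fderiv_comp_add_right, hfun]

include hω hA in
/-- **Uniform bounds for the sheet amplitude.** For any three directions `e i` there is `C_A ≥ 0` with
`|A| ≤ C_A`, `|∂_{eᵢ}A| ≤ C_A` and `|∂_{eⱼ}∂_{eᵢ}A| ≤ C_A` everywhere (continuity + `4π`-periodicity).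
[folklore] -/
theorem resonance_A_bounds (e : Fin 3 → ℝ × ℝ × ℝ) :
    ∃ C : ℝ, 0 ≤ C ∧ ∀ p : ℝ × ℝ × ℝ, |A p| ≤ C ∧ (∀ i, |fderiv ℝ A p (e i)| ≤ C) ∧
      (∀ i j, |fderiv ℝ (fun q => fderiv ℝ A q (e i)) p (e j)| ≤ C) := by
  have hA2 : ContDiff ℝ 2 A := resonance_contDiff_A hω hA 2
  obtain ⟨P1, P2, P3⟩ := resonance_A_periodic hA
  have h4π : (0 : ℝ) < 4 * Real.pi := by positivity
  -- order 0
  obtain ⟨C₀, hC₀⟩ := exists_bound_of_periodic3 hA2.continuous h4π P1 P2 P3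
  -- order 1: the scalar partials `p ↦ ∂_{e i} A (p)`
  have hD1c : Continuous fun p => fderiv ℝ A p := hA2.continuous_fderiv (by norm_num)
  have hD1p : ∀ T : ℝ × ℝ × ℝ, (∀ q, A (q + T) = A q) → ∀ q, fderiv ℝ A (q + T) = fderiv ℝ A q :=
    fun T hT q => fderiv_periodic_vec hT q
  have h1 : ∀ i, ∃ C : ℝ, ∀ p, |fderiv ℝ A p (e i)| ≤ C := fun i =>
    exists_bound_of_periodic3 (f := fun p => fderiv ℝ A p (e i)) (hD1c.clm_apply continuous_const) h4π
      (fun q => by simp only [hD1p _ P1 q]) (fun q => by simp only [hD1p _ P2 q])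
      (fun q => by simp only [hD1p _ P3 q])
  obtain ⟨C₁, hC₁0, hC₁⟩ := exists_common_bound h1
  -- order 2: the scalar second partials
  have hAi : ∀ i, ContDiff ℝ 1 fun q => fderiv ℝ A q (e i) := fun i =>
    (hA2.fderiv_right (m := 1) (by norm_num)).clm_apply contDiff_const
  have hpi : ∀ i (T : ℝ × ℝ × ℝ), (∀ q, A (q + T) = A q) →
      ∀ q, fderiv ℝ (fun r => fderiv ℝ A r (e i)) (q + T) = fderiv ℝ (fun r => fderiv ℝ A r (e i)) q :=
    fun i T hT q => fderiv_periodic_vec (g := fun r => fderiv ℝ A r (e i)) (fun r => by simp only [hD1p T hT r]) q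
  have h2 : ∀ ij : Fin 3 × Fin 3, ∃ C : ℝ, ∀ p,
      |fderiv ℝ (fun q => fderiv ℝ A q (e ij.1)) p (e ij.2)| ≤ C := fun ij =>
    exists_bound_of_periodic3 (f := fun p => fderiv ℝ (fun q => fderiv ℝ A q (e ij.1)) p (e ij.2))
      (((hAi ij.1).continuous_fderiv one_ne_zero).clm_apply continuous_const) h4π
      (fun q => by simp only [hpi _ _ P1 q]) (fun q => by simp only [hpi _ _ P2 q])
      (fun q => by simp only [hpi _ _ P3 q])
  obtain ⟨C₂, hC₂0, hC₂⟩ := exists_common_bound h2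
  refine ⟨|C₀| + C₁ + C₂, by positivity, fun p => ⟨?_, fun i => ?_, fun i j => ?_⟩⟩
  · exact (hC₀ p).trans ((le_abs_self _).trans (by linarith))
  · have := hC₁ i p
    have h0 := abs_nonneg C₀
    linarith
  · have := hC₂ (i, j) p
    have h0 := abs_nonneg C₀
    linarith

/-! ### First derivatives of `S₁`, `S₂` and the product rule for `Ω` -/

include hS₁ in
/-- `DS₁(p)v = ½cos((k₃−k₁)/2)·(v₃ − v₁)` (`v = (v₁,(v₃,v₂))`). [folklore] -/
theorem resonance_fderiv_S₁ (p v : ℝ × ℝ × ℝ) :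
    fderiv ℝ S₁ p v = Real.cos ((p.2.1 - p.1) / 2) / 2 * (v.2.1 - v.1) := by
  have hfun : S₁ = fun q : ℝ × ℝ × ℝ => Real.sin (1 / 2 * (q.2.1 - q.1)) := by
    funext q; rw [hS₁]; congr 1; ring
  set L : ℝ × ℝ × ℝ →L[ℝ] ℝ :=
    (ContinuousLinearMap.fst ℝ ℝ ℝ).comp (ContinuousLinearMap.snd ℝ ℝ (ℝ × ℝ)) - ContinuousLinearMap.fst ℝ ℝ (ℝ × ℝ)
    with hL
  have hsub : HasFDerivAt (fun q : ℝ × ℝ × ℝ => q.2.1 - q.1) L p :=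
    (hasFDerivAt_fst.comp p hasFDerivAt_snd).sub hasFDerivAt_fst
  have hlin : HasFDerivAt (fun q : ℝ × ℝ × ℝ => 1 / 2 * (q.2.1 - q.1)) ((1 / 2 : ℝ) • L) p := hsub.const_mul (1 / 2)
  have hsin : HasFDerivAt (fun q : ℝ × ℝ × ℝ => Real.sin (1 / 2 * (q.2.1 - q.1)))
      (Real.cos (1 / 2 * (p.2.1 - p.1)) • ((1 / 2 : ℝ) • L)) p :=
    (Real.hasDerivAt_sin _).comp_hasFDerivAt p hlin
  rw [hfun, hsin.fderiv]
  simp only [FunLike.coe_smul, Pi.smul_apply, smul_eq_mul, hL, FunLike.coe_sub,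
    Pi.sub_apply, ContinuousLinearMap.coe_comp, Function.comp_apply, ContinuousLinearMap.coe_fst',
    ContinuousLinearMap.coe_snd']
  rw [show 1 / 2 * (p.2.1 - p.1) = (p.2.1 - p.1) / 2 by ring]
  ring

include hS₂ in
/-- `DS₂(p)v = ½cos((k₃−k₂)/2)·(v₃ − v₂)` (`v = (v₁,(v₃,v₂))`). [folklore] -/
theorem resonance_fderiv_S₂ (p v : ℝ × ℝ × ℝ) :
    fderiv ℝ S₂ p v = Real.cos ((p.2.1 - p.2.2) / 2) / 2 * (v.2.1 - v.2.2) := by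
  have hfun : S₂ = fun q : ℝ × ℝ × ℝ => Real.sin (1 / 2 * (q.2.1 - q.2.2)) := by
    funext q; rw [hS₂]; congr 1; ring
  set L : ℝ × ℝ × ℝ →L[ℝ] ℝ :=
    (ContinuousLinearMap.fst ℝ ℝ ℝ).comp (ContinuousLinearMap.snd ℝ ℝ (ℝ × ℝ)) -
      (ContinuousLinearMap.snd ℝ ℝ ℝ).comp (ContinuousLinearMap.snd ℝ ℝ (ℝ × ℝ)) with hL
  have hsub : HasFDerivAt (fun q : ℝ × ℝ × ℝ => q.2.1 - q.2.2) L p :=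
    (hasFDerivAt_fst.comp p hasFDerivAt_snd).sub (hasFDerivAt_snd.comp p hasFDerivAt_snd)
  have hlin : HasFDerivAt (fun q : ℝ × ℝ × ℝ => 1 / 2 * (q.2.1 - q.2.2)) ((1 / 2 : ℝ) • L) p :=
    hsub.const_mul (1 / 2)
  have hsin : HasFDerivAt (fun q : ℝ × ℝ × ℝ => Real.sin (1 / 2 * (q.2.1 - q.2.2)))
      (Real.cos (1 / 2 * (p.2.1 - p.2.2)) • ((1 / 2 : ℝ) • L)) p :=
    (Real.hasDerivAt_sin _).comp_hasFDerivAt p hlin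
  rw [hfun, hsin.fderiv]
  simp only [FunLike.coe_smul, Pi.smul_apply, smul_eq_mul, hL, FunLike.coe_sub,
    Pi.sub_apply, ContinuousLinearMap.coe_comp, Function.comp_apply, ContinuousLinearMap.coe_fst',
    ContinuousLinearMap.coe_snd']
  rw [show 1 / 2 * (p.2.1 - p.2.2) = (p.2.1 - p.2.2) / 2 by ring]
  ring

include hω hS₁ hS₂ hA in
/-- **The product rule for `Ω = −A·S₁·S₂`:**
`DΩ(p)v = −(DA(p)v·S₁S₂ + A·½cos((k₃−k₁)/2)(v₃−v₁)·S₂ + A·S₁·½cos((k₃−k₂)/2)(v₃−v₂))`. [folklore] -/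
theorem resonance_fderiv_Omega (p v : ℝ × ℝ × ℝ) :
    fderiv ℝ (fun q : ℝ × ℝ × ℝ => resonanceFn ω₂ q.1 q.2.2 q.2.1) p v =
      -(fderiv ℝ A p v * S₁ p * S₂ p + A p * (Real.cos ((p.2.1 - p.1) / 2) / 2 * (v.2.1 - v.1)) * S₂ p +
          A p * S₁ p * (Real.cos ((p.2.1 - p.2.2) / 2) / 2 * (v.2.1 - v.2.2))) := by
  have hfun : (fun q : ℝ × ℝ × ℝ => resonanceFn ω₂ q.1 q.2.2 q.2.1) = fun q => -(A q * S₁ q * S₂ q) :=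
    funext fun q => resonance_product_identity hω hS₁ hS₂ hA q
  rw [hfun, fderiv_fun_neg]
  have hAd : DifferentiableAt ℝ A p := ((resonance_contDiff_A hω hA 1).differentiable one_ne_zero) p
  have h1d : DifferentiableAt ℝ S₁ p := ((resonance_contDiff_S₁ hS₁ 1).differentiable one_ne_zero) p
  have h2d : DifferentiableAt ℝ S₂ p := ((resonance_contDiff_S₂ hS₂ 1).differentiable one_ne_zero) p
  have hAS : DifferentiableAt ℝ (fun q => A q * S₁ q) p := hAd.mul h1d
  simp only [neg_apply]
  rw [fp_mul hAS h2d, fp_mul hAd h1d, resonance_fderiv_S₁ hS₁, resonance_fderiv_S₂ hS₂]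
  ring

end Structure

/-- **Registered sub-goal `resonance_product_structure` of stub B1b″ (packaging).** For `ω₂ > 0`, with
`S₁ = sin((k₃−k₁)/2)`, `S₂ = sin((k₃−k₂)/2)` and `A = 8H/Q` read at `p = (k₁,(k₃,k₂))`: `Ω = −A·S₁·S₂`,
`A` is smooth, and `DΩ(p)v = −(DA(p)v·S₁S₂ + A·½cos((k₃−k₁)/2)(v₃−v₁)·S₂ + A·S₁·½cos((k₃−k₂)/2)(v₃−v₂))`.
[folklore] -/
theorem resonance_product_structure :
    ∀ ω₂ : ℝ, 0 < ω₂ → ∀ (A S₁ S₂ : ℝ × ℝ × ℝ → ℝ),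
      (∀ p : ℝ × ℝ × ℝ, S₁ p = Real.sin ((p.2.1 - p.1) / 2)) →
      (∀ p : ℝ × ℝ × ℝ, S₂ p = Real.sin ((p.2.1 - p.2.2) / 2)) →
      (∀ p : ℝ × ℝ × ℝ, A p =
        8 * ((dispersion ω₂ p.1 * dispersion ω₂ p.2.2 +
                dispersion ω₂ p.2.1 * dispersion ω₂ (p.1 + p.2.2 - p.2.1) + 2 * (ω₂ + 2)) *
              Real.cos ((p.1 + p.2.2) / 2) -
            4 * Real.cos ((p.2.1 - p.1) / 2) * Real.cos ((p.2.2 - p.2.1) / 2)) /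
          ((dispersion ω₂ p.1 + dispersion ω₂ p.2.2 + dispersion ω₂ p.2.1 + dispersion ω₂ (p.1 + p.2.2 - p.2.1)) *
            (dispersion ω₂ p.1 * dispersion ω₂ p.2.2 +
              dispersion ω₂ p.2.1 * dispersion ω₂ (p.1 + p.2.2 - p.2.1)))) →
      (∀ p : ℝ × ℝ × ℝ, resonanceFn ω₂ p.1 p.2.2 p.2.1 = -(A p * S₁ p * S₂ p)) ∧
        (∀ n : ℕ, ContDiff ℝ n A) ∧
        (∀ p v : ℝ × ℝ × ℝ, fderiv ℝ (fun q : ℝ × ℝ × ℝ => resonanceFn ω₂ q.1 q.2.2 q.2.1) p v =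
          -(fderiv ℝ A p v * S₁ p * S₂ p + A p * (Real.cos ((p.2.1 - p.1) / 2) / 2 * (v.2.1 - v.1)) * S₂ p +
              A p * S₁ p * (Real.cos ((p.2.1 - p.2.2) / 2) / 2 * (v.2.1 - v.2.2)))) :=
  fun _ hω _ _ _ hS₁ hS₂ hA =>
    ⟨resonance_product_identity hω hS₁ hS₂ hA, resonance_contDiff_A hω hA, resonance_fderiv_Omega hω hS₁ hS₂ hA⟩

end Summit.AtomisticToContinuum.FouriersLaw.Theorems.DrudeDissolution.KineticPolymerGasOnTheTimeAxis

end
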